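import Summits.ResolutionOfSingularities.ResolutionOfSingularities.Theorems.SeparableGaloisGaloisQuotientModelsCalibration
import HarnessLib

/-!
# Calibration of (MD), degenerate instances: regular `X`

Companion to `SeparableGaloisGaloisQuotientModelsCalibration.lean` (crux `GaloisQuotientModels`,
stmt-ResolutionOfSingularities-18955, line `inseparability-foliation-quotient`): the sanity inhabitants
`hasSeparableGaloisTop_of_isRegular` (a regular quasi-projective `X` is its own separable Galois top,
`G = 1`, `π = 𝟙`) and `multiplicativeDefect_of_isRegular` (hence the open stub (MD) holds at every
regular quasi-projective `X`, non-vacuously: its level-`0` sandwich models are `X` itself with the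
trivial log structure). [cite: DeJong1997, 5.3] [cite: Kato1994, (2.2)(1)]
-/

noncomputable section

set_option linter.dupNamespace false

open CategoryTheory AlgebraicGeometry TopologicalSpace
open Literature.AlgebraicGeometry.Resolution
open Literature.AlgebraicGeometry.Motives Literature.AlgebraicGeometry.Motives.RatFn

namespace Summit.ResolutionOfSingularities.ResolutionOfSingularities.Theorems.GaloisQuotientModels

/-- **Degenerate instance (sanity): a regular `X` is its own separable Galois top.** For a regular
integral `X` whose finite subsets lie in affine opens, `HasSeparableGaloisTop X` holds with the
trivial group and `π' = 𝟙 X` (the identity is birational, hence an alteration; `(𝟙 X)♯ = id`).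
[cite: DeJong1997, 5.3 (the datum, trivial case)] -/
theorem hasSeparableGaloisTop_of_isRegular {X : Scheme.{0}} [IsIntegral X]
    (hreg : Scheme.IsRegular X)
    (hXaff : ∀ S : Finset X, ∃ U : X.Opens, IsAffineOpen U ∧ (↑S : Set X) ⊆ U) :
    HasSeparableGaloisTop X := by
  have hb : IsBirational (𝟙 X) :=
    ⟨⊤, by simp [dense_univ], by simp [dense_univ], inferInstance⟩
  refine ⟨Unit, inferInstance, inferInstance, X, inferInstance, 1, 𝟙 X, inferInstance,
    hb.isAlteration, hreg, fun _ _ _ => Subsingleton.elim _ _, fun _ => ?_, hXaff, fun a _ => ?_⟩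
  · simp only [MonoidHom.one_apply]
    exact Category.comp_id _
  · refine ⟨a, ?_⟩
    rw [functionFieldMap_id]
    rfl

/-- **Degenerate instance (sanity): (MD) holds for regular `X`.** For a regular integral `X`,
locally of finite type over a field, whose finite subsets lie in affine opens, the conclusion of the
open stub `stub_multiplicativeDefect` holds for every `p` (trivial group, `n = 0`, trivial log
structure) — a non-vacuous inhabitant of its `∀ Z` clause. [cite: Kato1994, (2.2)(1)] -/
theorem multiplicativeDefect_of_isRegular (p : ℕ) {k : Type} [Field k] {X : Scheme.{0}}
    [IsIntegral X] (f : X ⟶ Spec (.of k)) [LocallyOfFiniteType f] (hreg : Scheme.IsRegular X)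
    (hXaff : ∀ S : Finset X, ∃ U : X.Opens, IsAffineOpen U ∧ (↑S : Set X) ⊆ U) :
    ∃ (G : Type) (_ : Group G) (_ : Finite G) (X₁ : Scheme.{0}) (_ : IsIntegral X₁)
      (ρ : G →* Aut X₁) (π : X₁ ⟶ X) (_ : IsDominant π) (n : ℕ),
      IsGaloisAlterationOfExponent p n ρ π ∧
      ∀ (Z : Scheme.{0}) [IsIntegral Z] (ρZ : G →* Aut Z) (u : X₁ ⟶ Z) [IsDominant u]
        (v : Z ⟶ X), IsSandwichModel p n ρ π ρZ u v →
        ∃ 𝒜 : LogAtlas.{0} Z, 𝒜.IsLogRegular ∧ IsLogEquivariant 𝒜 ρZ :=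
  multiplicativeDefect_of_hasSeparableGaloisTop p f (hasSeparableGaloisTop_of_isRegular hreg hXaff)

end Summit.ResolutionOfSingularities.ResolutionOfSingularities.Theorems.GaloisQuotientModels

end
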